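import Mathlib.Analysis.SpecialFunctions.Pow.Deriv
import Mathlib.Analysis.SpecialFunctions.Pow.Continuity
import Literature.NumberTheory.Transcendental.KZCalculusProofs

/-!
# Terasoma multiplication, complete mod-`Γ` sector: the `t`-potential of the Elliott certificate

Engine client E-L2a of the cusp transport `ElliottToCusp`: the potential
`P(v) = v^{1-a} (1-v)^{c+a-1} (1 - s v)^{-a} · u^{1-a} (1-u)^{c+a-2} (1-(1-s)u)^{-a}`
is continuous in `v` on `[0,1]` (the exponents `1 - a` and `c + a - 1` are positive), vanishes on
the two faces `v = 0`, `v = 1`, and inside `(0,1)` its derivative is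
`g₁(t) = K(t,u,s) · u · [(1-2t) - a(1-t) - (c+a-2)t + a s t(1-t)/(1-st)]` with the kernel
`K(t,u,s) = t^{-a}(1-t)^{c+a-2}(1-st)^{-a} u^{-a}(1-u)^{c+a-2}(1-(1-s)u)^{-a}`.
Elementary real analysis (`Real.rpow` calculus); everything is proved, no `def`, no named fact.
-/

noncomputable section
set_option linter.dupNamespace false

namespace Summit.KontsevichZagierPeriods.KontsevichZagierPeriods.CompleteModGammaSectorEngine

open MeasureTheory Set
open Literature.NumberTheory.Transcendental
open Literature.NumberTheory.Transcendental.KZ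

/-- potential P = t^{1−a}(1−t)^{c+a−1}(1−st)^{−a}·u^{1−a}(1−u)^{c+a−2}(1−(1−s)u)^{−a}: continuous in t on [0,1] (exponents 1−a, c+a−1 > 0), zero on the faces, ∂ₜP = g₁ inside -/
theorem stub_elliottPotentialT :
    ∀ (a c : ℚ) (u s : ℝ), 0 < a → a < 1 → 1 - a < c → u ∈ Set.Ioo (0:ℝ) 1 → s ∈ Set.Ioo (0:ℝ) 1 → ContinuousOn (fun v : ℝ => (v ^ (1 - (a : ℝ)) * (1 - v) ^ ((c : ℝ) + (a : ℝ) - 1) * (1 - s * v) ^ (-(a : ℝ)) * u ^ (1 - (a : ℝ)) * (1 - u) ^ ((c : ℝ) + (a : ℝ) - 2) * (1 - (1 - s) * u) ^ (-(a : ℝ)))) (Set.Icc (0:ℝ) 1) ∧ ((0:ℝ) ^ (1 - (a : ℝ)) * (1 - (0:ℝ)) ^ ((c : ℝ) + (a : ℝ) - 1) * (1 - s * (0:ℝ)) ^ (-(a : ℝ)) * u ^ (1 - (a : ℝ)) * (1 - u) ^ ((c : ℝ) + (a : ℝ) - 2) * (1 - (1 - s) * u) ^ (-(a : ℝ))) =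 0 ∧ ((1:ℝ) ^ (1 - (a : ℝ)) * (1 - (1:ℝ)) ^ ((c : ℝ) + (a : ℝ) - 1) * (1 - s * (1:ℝ)) ^ (-(a : ℝ)) * u ^ (1 - (a : ℝ)) * (1 - u) ^ ((c : ℝ) + (a : ℝ) - 2) * (1 - (1 - s) * u) ^ (-(a : ℝ))) = 0 ∧ ∀ t ∈ Set.Ioo (0:ℝ) 1, HasDerivAt (fun v : ℝ => (v ^ (1 - (a : ℝ)) * (1 - v) ^ ((c : ℝ) + (a : ℝ) - 1) * (1 - s * v) ^ (-(a : ℝ)) * u ^ (1 - (a : ℝ)) * (1 - u) ^ ((c : ℝ) + (a : ℝ) - 2) * (1 - (1 - s) * u) ^ (-(a : ℝ)))) ((t ^ (-(a : ℝ)) * (1 - t) ^ ((c : ℝ) + (a : ℝ) - 2) * (1 - s * t) ^ (-(a : ℝ)) * u ^ (-(a : ℝ)) * (1 - u) ^ ((c : ℝ) + (a : ℝ) - 2) * (1 - (1 - s) * u) ^ (-(a : ℝ))) * u * ((1 - 2 * t) - (a : ℝ) * (1 - t) - ((c : ℝ) + (a : ℝ) - 2) * t + (a : ℝ) * s * t *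 (1 - t) / (1 - s * t))) t := by
  intro a c u s ha0 ha1 hac hu hs
  have hα0 : (0:ℝ) < (a:ℝ) := by exact_mod_cast ha0
  have hα1 : ((a:ℚ):ℝ) < 1 := by exact_mod_cast ha1
  have hγ : 1 - ((a:ℚ):ℝ) < ((c:ℚ):ℝ) := by exact_mod_cast hac
  set α : ℝ := (a:ℝ) with hαdef
  set γ : ℝ := (c:ℝ) with hγdef
  have hne1 : (1:ℝ) - α ≠ 0 := (sub_pos.2 hα1).ne'
  have hpos2 : (0:ℝ) < γ + α - 1 := by linarith
  have hne2 : γ + α - 1 ≠ 0 := hpos2.ne'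
  refine ⟨?_, ?_, ?_, ?_⟩
  · -- continuity on `[0,1]`: positive exponents on the moving factors, `1 - s v ≥ 1 - s > 0`
    have h1 : ContinuousOn (fun v : ℝ => v ^ (1 - α)) (Set.Icc (0:ℝ) 1) :=
      continuousOn_id.rpow_const fun v _ => Or.inr (sub_pos.2 hα1).le
    have h2 : ContinuousOn (fun v : ℝ => (1 - v) ^ (γ + α - 1)) (Set.Icc (0:ℝ) 1) :=
      (continuousOn_const.sub continuousOn_id).rpow_const fun v _ => Or.inr hpos2.le
    have h3 : ContinuousOn (fun v : ℝ => (1 - s * v) ^ (-α)) (Set.Icc (0:ℝ) 1) := by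
      refine (continuousOn_const.sub (continuousOn_const.mul continuousOn_id)).rpow_const
        fun v hv => Or.inl ?_
      have hv1 : v ≤ 1 := hv.2
      have hsv : s * v ≤ s := by nlinarith [hs.1]
      have hpos : (0:ℝ) < 1 - s * v := by linarith [hs.2]
      exact hpos.ne'
    exact ((((h1.mul h2).mul h3).mul continuousOn_const).mul continuousOn_const).mul
      continuousOn_const
  · -- the face `v = 0`
    simp only [Real.zero_rpow hne1, zero_mul]
  · -- the face `v = 1`
    simp only [sub_self, Real.zero_rpow hne2, mul_zero, zero_mul]
  · -- the derivative inside `(0,1)`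
    intro t ht
    have ht0 : 0 < t := ht.1
    have h1t : 0 < 1 - t := by linarith [ht.2]
    have hst : 0 < 1 - s * t := by nlinarith [hs.1, hs.2, ht.1, ht.2]
    have hd1 : HasDerivAt (fun v : ℝ => v ^ (1 - α)) ((1 - α) * t ^ (-α)) t := by
      have h := Real.hasDerivAt_rpow_const (p := 1 - α) (Or.inl ht0.ne')
      refine h.congr_deriv ?_
      rw [show (1:ℝ) - α - 1 = -α by ring]
    have hd2 : HasDerivAt (fun v : ℝ => (1 - v) ^ (γ + α - 1))
        (-((γ + α - 1) * (1 - t) ^ (γ + α - 2))) t := by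
      have h := ((hasDerivAt_id t).const_sub 1).rpow_const (p := γ + α - 1)
        (Or.inl (by simp only [id]; exact h1t.ne'))
      refine h.congr_deriv ?_
      simp only [id]
      rw [show γ + α - 1 - 1 = γ + α - 2 by ring]
      ring
    have hd3 : HasDerivAt (fun v : ℝ => (1 - s * v) ^ (-α))
        (α * s * (1 - s * t) ^ (-α - 1)) t := by
      have h := (((hasDerivAt_id t).const_mul s).const_sub 1).rpow_const (p := -α)
        (Or.inl (by simp only [id]; exact hst.ne'))
      refine h.congr_deriv ?_
      simp only [id]
      ring
    have hd := ((((hd1.fun_mul hd2).fun_mul hd3).mul_const (u ^ (1 - α))).mul_const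
      ((1 - u) ^ (γ + α - 2))).mul_const ((1 - (1 - s) * u) ^ (-α))
    refine hd.congr_deriv ?_
    have e1 : t ^ (1 - α) = t ^ (-α) * t := by
      rw [sub_eq_neg_add, Real.rpow_add_one ht0.ne']
    have e2 : (1 - t) ^ (γ + α - 1) = (1 - t) ^ (γ + α - 2) * (1 - t) := by
      rw [← Real.rpow_add_one h1t.ne']
      congr 1
      ring
    have e3 : (1 - s * t) ^ (-α - 1) = (1 - s * t) ^ (-α) / (1 - s * t) :=
      Real.rpow_sub_one hst.ne' (-α)
    have e4 : u ^ (1 - α) = u ^ (-α) * u := by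
      rw [sub_eq_neg_add, Real.rpow_add_one hu.1.ne']
    rw [e1, e2, e3, e4]
    ring

end Summit.KontsevichZagierPeriods.KontsevichZagierPeriods.CompleteModGammaSectorEngine
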